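import Literature.Analysis.FluidPDE.PassiveScalarDiagEnergyContinuityCorollaries
import HarnessLib

/-!
# Periodic stirring: a one-period `L²` contraction propagates to `κ`-uniform exponential decay
# of EVERY weak solution (the engine of Hess-Childs–Rowan 2025b, Cor. 1.2)

Analysis/FluidPDE proof file (everything proved; no definitions). Setting: the diagonal-diffusion
passive scalar equation `∂ₜθ + u·∇θ = κ ∑ᵢ aᵢ ∂ᵢ∂ᵢθ` on `T^d × [0,T)` in the DiPerna–Lions weak class
`Torus.IsWeakScalarTransportDiagOn T a κ u θ₀ θ` (`κ > 0`, `aᵢ > 0`), with a BOUNDED drift which is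
`L`-periodic in time on `t ≥ 0`.

Hypothesis `(P_q)` — the one-period bound, in the shape of the Hess-Childs–Rowan statements
(`HessChildsRowan2025a.DissipatesTotally/DissipatesAllNorms`, `HessChildsRowan2025_cor12`): for every
mean-zero `φ₀ ∈ L²` and every weak solution `φ` on `[0,L)` from `φ₀` which is the `L²`-continuous
representative on `[0,L]`, `‖φ(L)‖²_{L²} ≤ q² ‖φ₀‖²_{L²}`.

Conclusion: for every horizon `T`, every mean-zero `θ₀ ∈ L²` and EVERY weak solution `θ` on `[0,T)`,
`‖θ(t)‖²_{L²} ≤ q^{2⌊t/L⌋} ‖θ₀‖²_{L²}` — at every `t ∈ [0,T]` for the `L²`-continuous representative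
(`IsWeakScalarTransportDiagOn.scalarL2Sq_le_pow_of_isL2ContinuousOn`), and for a.e. `t ∈ (0,T)` for an
arbitrary weak solution (`IsWeakScalarTransportDiagOn.ae_scalarL2Sq_le_pow`). This is exactly the
argument of Hess-Childs–Rowan 2025b, §1.3 (proof of Cor. 1.2: "per period,
`‖θ(n+1+r)‖ ≤ ‖θ(n+1)‖ ≤ C κ^{(1-α)²/24} ‖θ(n)‖` … by periodicity"), written once for the class:
restart from the own slice at `nL` (`translate_of_isL2ContinuousOn`), the phase-`nL` problem is the
phase-`0` problem (periodicity, `congr_velocity`), the mean stays zero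
(`integral_eq_zero_of_isL2ContinuousOn`), the solution map is an `L²`-contraction inside each period
(`scalarL2Sq_le_of_isL2ContinuousOn`), induction on `n`, and finally every weak solution agrees at
a.e. time with its `L²`-continuous representative (`exists_l2Continuous_representative`). With
`q = C κ^γ` the rate `⌊t/L⌋ log(1/q) = ⌊t/L⌋ (γ log κ⁻¹ - log C)` ACCELERATES as `κ → 0` — the
mechanism of "accelerating dissipation enhancement"; so a typed one-period `L²` bound for a periodic
field yields the `HessChildsRowan2025_cor12`-type statement for all weak solutions, and the
relaxation clause `(U_h)` of charge–discharge bookkeeping (unforced problem) is the case `q ≤ 1/2`.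

## Mathlib / tree search

`IsWeakScalarTransportDiagOn.translate_of_isL2ContinuousOn` / `scalarL2Sq_le_of_isL2ContinuousOn` /
`scalarL2Sq_le_datum_of_isL2ContinuousOn` (`PassiveScalarDiagEnergyContinuityCorollaries`);
`IsWeakScalarTransportDiagForcedOn.congr_velocity` / `mono` / `integral_eq_zero_of_isL2ContinuousOn` /
`exists_l2Continuous_representative`; `isWeakScalarTransportDiagForcedOn_zero_iff`;
`lintegral_source_zero'`. `lean search 'pow_of_period|periodic.*contraction'`: nothing for this class.

## References

* E. Hess-Childs, K. Rowan, arXiv:2508.00115 (2025), Cor. 1.2 and its proof, §1.3 p. 11.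
  [`HessChildsRowan2025b`]
* R. J. DiPerna, P.-L. Lions, Invent. Math. 98 (1989), §II.1 (12)–(14). [`DiPernaLions1989`]
-/

noncomputable section

open MeasureTheory Set Filter UnitAddTorus
open _root_.Topology
open scoped ENNReal NNReal

namespace Literature.Analysis.FluidPDE

namespace Torus

open Literature.Analysis.FunctionSpaces.Torus Literature.Analysis.FunctionSpaces

variable {d : Type*} [Fintype d] [DecidableEq d]

/-! ## Bookkeeping: integer phases of a periodic drift; shifts of `L²`-continuous fields -/

omit [Fintype d] [DecidableEq d] in
/-- Integer multiples of the period are phases: `v (nL + t) = v t` for `t ≥ 0`. [folklore] -/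
private theorem periodic_natMul_add {X : Type*} {v : ℝ → X} {L : ℝ} (hL : 0 ≤ L)
    (hper : ∀ t : ℝ, 0 ≤ t → v (t + L) = v t) (n : ℕ) {t : ℝ} (ht : 0 ≤ t) :
    v (n * L + t) = v t := by
  induction n generalizing t with
  | zero => simp
  | succ n ih =>
    have e : ((n + 1 : ℕ) : ℝ) * L + t = (n * L + t) + L := by push_cast; ring
    rw [e, hper _ (by positivity), ih ht]

omit [DecidableEq d] in
/-- A shift of an `L²`-continuous field is `L²`-continuous: if `θ ∈ C([0,T]; L²)`, `0 ≤ σ` and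
`σ + T' ≤ T`, then `t ↦ θ(σ + t) ∈ C([0,T']; L²)`. [folklore] -/
private theorem isL2ContinuousOn_translate {θ : ℝ → UnitAddTorus d → ℝ} {T σ T' : ℝ}
    (hc : IsL2ContinuousOn (Icc 0 T) θ) (hσ : 0 ≤ σ) (hT' : σ + T' ≤ T) :
    IsL2ContinuousOn (Icc 0 T') (fun t => θ (σ + t)) := by
  have hmaps : MapsTo (fun t : ℝ => σ + t) (Icc 0 T') (Icc 0 T) := fun t ht =>
    ⟨by linarith [ht.1], by linarith [ht.2]⟩
  refine ⟨fun t ht => hc.1 _ (hmaps ht), fun t₀ ht₀ => ?_⟩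
  have hg : Tendsto (fun t : ℝ => σ + t) (𝓝[Icc 0 T'] t₀) (𝓝[Icc 0 T] (σ + t₀)) :=
    ((continuous_const.add continuous_id).continuousWithinAt).tendsto_nhdsWithin hmaps
  exact (hc.2 (σ + t₀) (hmaps ht₀)).comp hg

namespace IsWeakScalarTransportDiagOn

variable {T κ L q A : ℝ} {a : d → ℝ} {u : ℝ → UnitAddTorus d → EuclideanSpace ℝ d}
  {θ₀ : UnitAddTorus d → ℝ} {θ : ℝ → UnitAddTorus d → ℝ}

/-- A pointwise bounded drift is in `L^∞` of every slab on which it is measurable — and measurability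
on the slab of a weak solution is part of the weak-solution structure. [cite: DiPernaLions1989, §II.1 (12)–(14)] -/
theorem memLp_top_velocity (h : IsWeakScalarTransportDiagOn T a κ u θ₀ θ)
    (huA : ∀ t x, ‖u t x‖ ≤ A) : MemLp (stLift u) ⊤ (volume.restrict (Ioo 0 T ×ˢ univ)) :=
  memLp_top_of_bound h.aestronglyMeasurable_velocity A (Eventually.of_forall fun p => by
    obtain ⟨t, y⟩ := p
    simpa only [stLift_apply] using huA t _)

/-- **One-period contraction ⇒ geometric decay at every time, `L²`-continuous representative.**
Let `κ > 0`, `aᵢ > 0`, `L > 0`, let the drift be bounded and `L`-periodic on `t ≥ 0`, and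
assume the one-period bound `(P_q)`: every `L²`-continuous weak solution on `[0,L]` from mean-zero
`L²` data has `‖φ(L)‖² ≤ q² ‖φ₀‖²`. Then every weak solution `θ ∈ C([0,T]; L²)` from mean-zero
`θ₀ ∈ L²` satisfies `‖θ(t)‖² ≤ q^{2⌊t/L⌋} ‖θ₀‖²` for EVERY `t ∈ [0,T]` (Hess-Childs–Rowan 2025b,
§1.3: restart at `nL`, periodicity, mean preservation, contraction inside the period, induction).
[cite: HessChildsRowan2025b, Cor. 1.2 (proof §1.3, p. 11)] -/
theorem scalarL2Sq_le_pow_of_isL2ContinuousOn (hκ : 0 < κ) (ha : ∀ i, 0 < a i) (hL : 0 < L)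
    (hper : ∀ t : ℝ, 0 ≤ t → u (t + L) = u t) (huA : ∀ t x, ‖u t x‖ ≤ A)
    (hP : ∀ φ₀ : UnitAddTorus d → ℝ, MemLp φ₀ 2 volume → ∫ x, φ₀ x = 0 →
      ∀ φ : ℝ → UnitAddTorus d → ℝ, IsWeakScalarTransportDiagOn L a κ u φ₀ φ →
        IsL2ContinuousOn (Icc 0 L) φ → Torus.scalarL2Sq (φ L) ≤ q ^ 2 * Torus.scalarL2Sq φ₀)
    (h : IsWeakScalarTransportDiagOn T a κ u θ₀ θ) (hT : 0 < T) (hθ₀ : MemLp θ₀ 2 volume)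
    (hθ₀m : ∫ x, θ₀ x = 0) (hc : IsL2ContinuousOn (Icc 0 T) θ) :
    ∀ t ∈ Icc 0 T, Torus.scalarL2Sq (θ t) ≤ q ^ (2 * ⌊t / L⌋₊) * Torus.scalarL2Sq θ₀ := by
  have hu : MemLp (stLift u) ⊤ (volume.restrict (Ioo 0 T ×ˢ univ)) := h.memLp_top_velocity huA
  have h' : IsWeakScalarTransportDiagForcedOn T a κ u 0 θ₀ θ := isWeakScalarTransportDiagForcedOn_zero_iff.2 h
  -- mean zero at every time
  have hmean : ∀ σ ∈ Icc 0 T, ∫ x, θ σ x = 0 := fun σ hσ =>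
    h'.integral_eq_zero_of_isL2ContinuousOn hT hc hθ₀m (Eventually.of_forall fun _ => by simp) hσ
  -- the claim at the period starts, by induction
  have key : ∀ n : ℕ, ∀ t ∈ Icc 0 T, (n : ℝ) * L ≤ t →
      Torus.scalarL2Sq (θ t) ≤ q ^ (2 * n) * Torus.scalarL2Sq θ₀ := by
    intro n
    induction n with
    | zero =>
      intro t ht _
      simpa using h.scalarL2Sq_le_datum_of_isL2ContinuousOn hT hκ ha hθ₀ hu hc ht
    | succ n ih =>
      intro t ht hnt
      have hn1 : ((n + 1 : ℕ) : ℝ) * L = n * L + L := by push_cast; ring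
      rw [hn1] at hnt
      set σ : ℝ := n * L with hσdef
      have hσ0 : 0 ≤ σ := by rw [hσdef]; positivity
      have hσL : σ + L ≤ T := hnt.trans ht.2
      have hσT : σ < T := by linarith
      -- the restarted solution on `[0, L]`, with the phase-`nL` drift replaced by `u`
      have hres : IsWeakScalarTransportDiagOn L a κ u (θ σ) (fun t => θ (σ + t)) := by
        have h1 := (h.translate_of_isL2ContinuousOn hc hσ0 hσT)
        have h2 : IsWeakScalarTransportDiagForcedOn (T - σ) a κ (fun t => u (σ + t)) 0 (θ σ)
            (fun t => θ (σ + t)) := isWeakScalarTransportDiagForcedOn_zero_iff.2 h1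
        have h3 : IsWeakScalarTransportDiagForcedOn (T - σ) a κ u 0 (θ σ) (fun t => θ (σ + t)) :=
          h2.congr_velocity (u' := u) fun t ht => by
            rw [hσdef]
            exact (periodic_natMul_add hL.le hper n ht.1.le).symm
        exact isWeakScalarTransportDiagForcedOn_zero_iff.1 (h3.mono (by linarith))
      have hcres : IsL2ContinuousOn (Icc 0 L) (fun t => θ (σ + t)) := isL2ContinuousOn_translate hc hσ0 hσL
      have hstep := hP (θ σ) (hc.1 σ ⟨hσ0, hσT.le⟩) (hmean σ ⟨hσ0, hσT.le⟩) _ hres hcres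
      have hIH := ih σ ⟨hσ0, hσT.le⟩ le_rfl
      -- contraction from `(n+1)L` to `t`
      have hcontr := h.scalarL2Sq_le_of_isL2ContinuousOn hT hκ ha hθ₀ hu hc (t₁ := σ + L) (t₂ := t)
        (by positivity) hnt ht.2
      have hq2 : 0 ≤ q ^ 2 := by positivity
      calc Torus.scalarL2Sq (θ t) ≤ Torus.scalarL2Sq (θ (σ + L)) := hcontr
        _ ≤ q ^ 2 * Torus.scalarL2Sq (θ σ) := hstep
        _ ≤ q ^ 2 * (q ^ (2 * n) * Torus.scalarL2Sq θ₀) := mul_le_mul_of_nonneg_left hIH hq2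
        _ = q ^ (2 * (n + 1)) * Torus.scalarL2Sq θ₀ := by ring
  intro t ht
  refine key ⌊t / L⌋₊ t ht ?_
  have h1 : (⌊t / L⌋₊ : ℝ) ≤ t / L := Nat.floor_le (div_nonneg ht.1 hL.le)
  calc (⌊t / L⌋₊ : ℝ) * L ≤ t / L * L := mul_le_mul_of_nonneg_right h1 hL.le
    _ = t := div_mul_cancel₀ t hL.ne'

/-- **One-period contraction ⇒ geometric decay at a.e. time, for EVERY weak solution**
(Hess-Childs–Rowan 2025b, Cor. 1.2, class form). Under the hypotheses of
`scalarL2Sq_le_pow_of_isL2ContinuousOn` (`κ > 0`, `aᵢ > 0`, `L > 0`, bounded drift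
`L`-periodic on `t ≥ 0`, one-period bound `(P_q)` on `L²`-continuous solutions from mean-zero data),
every weak solution `θ` on `[0,T)` from mean-zero `θ₀ ∈ L²` — not necessarily a continuous
representative — satisfies `‖θ(t)‖²_{L²} ≤ q^{2⌊t/L⌋} ‖θ₀‖²_{L²}` for a.e. `t ∈ (0,T)` (it agrees at
a.e. time with its `L²`-continuous representative, `exists_l2Continuous_representative`). With
`q = C κ^γ` this is decay at the accelerating rate `⌊t/L⌋ (γ log κ⁻¹ - log C)`.
[cite: HessChildsRowan2025b, Cor. 1.2 (proof §1.3, p. 11)] -/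
theorem ae_scalarL2Sq_le_pow [Nonempty d] (hκ : 0 < κ) (ha : ∀ i, 0 < a i) (hL : 0 < L)
    (hper : ∀ t : ℝ, 0 ≤ t → u (t + L) = u t) (huA : ∀ t x, ‖u t x‖ ≤ A)
    (hP : ∀ φ₀ : UnitAddTorus d → ℝ, MemLp φ₀ 2 volume → ∫ x, φ₀ x = 0 →
      ∀ φ : ℝ → UnitAddTorus d → ℝ, IsWeakScalarTransportDiagOn L a κ u φ₀ φ →
        IsL2ContinuousOn (Icc 0 L) φ → Torus.scalarL2Sq (φ L) ≤ q ^ 2 * Torus.scalarL2Sq φ₀)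
    (h : IsWeakScalarTransportDiagOn T a κ u θ₀ θ) (hθ₀ : MemLp θ₀ 2 volume) (hθ₀m : ∫ x, θ₀ x = 0) :
    ∀ᵐ t ∂(volume.restrict (Ioo 0 T)),
      Torus.scalarL2Sq (θ t) ≤ q ^ (2 * ⌊t / L⌋₊) * Torus.scalarL2Sq θ₀ := by
  rcases le_or_gt T 0 with hT | hT
  · rw [Ioo_eq_empty_of_le hT, Measure.restrict_empty]
    rw [ae_zero]
    exact Filter.eventually_bot
  have hu : MemLp (stLift u) ⊤ (volume.restrict (Ioo 0 T ×ˢ univ)) := h.memLp_top_velocity huA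
  have h' : IsWeakScalarTransportDiagForcedOn T a κ u 0 θ₀ θ := isWeakScalarTransportDiagForcedOn_zero_iff.2 h
  obtain ⟨w, hw, hwc, hw0, hwae, -⟩ :=
    h'.exists_l2Continuous_representative hT hκ ha hθ₀ hu (by simp)
  have hwsol : IsWeakScalarTransportDiagOn T a κ u θ₀ w := isWeakScalarTransportDiagForcedOn_zero_iff.1 hw
  have hW := hwsol.scalarL2Sq_le_pow_of_isL2ContinuousOn hκ ha hL hper huA hP hT hθ₀ hθ₀m hwc
  filter_upwards [hwae, ae_restrict_mem measurableSet_Ioo] with t hwt htI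
  have e : Torus.scalarL2Sq (θ t) = Torus.scalarL2Sq (w t) :=
    integral_congr_ae (hwt.mono fun x hx => by simp only [hx])
  rw [e]
  exact hW t ⟨htI.1.le, htI.2.le⟩

omit [Fintype d] [DecidableEq d] in
/-- **Geometric-to-exponential bookkeeping**: for `0 < q ≤ 1`, `L > 0`, `t ≥ 0`,
`q^{2⌊t/L⌋} ≤ q⁻² e^{-(2 log q⁻¹ / L) t}` (`⌊t/L⌋₊ ≥ t/L - 1`). [folklore] -/
private theorem pow_two_mul_floor_le_exp {q L : ℝ} (hq0 : 0 < q) (hq1 : q ≤ 1) (hL : 0 < L)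
    (t : ℝ) : q ^ (2 * ⌊t / L⌋₊) ≤ q⁻¹ ^ 2 * Real.exp (-(2 * Real.log q⁻¹ / L) * t) := by
  have hn : t / L - 1 ≤ (⌊t / L⌋₊ : ℝ) := (Nat.sub_one_lt_floor (t / L)).le
  have hlog : Real.log q ≤ 0 := Real.log_nonpos hq0.le hq1
  have e1 : q ^ (2 * ⌊t / L⌋₊) = Real.exp ((2 * (⌊t / L⌋₊ : ℝ)) * Real.log q) := by
    rw [← Real.exp_log (pow_pos hq0 (2 * ⌊t / L⌋₊)), Real.log_pow]
    push_cast
    ring_nf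
  have e2 : q⁻¹ ^ 2 * Real.exp (-(2 * Real.log q⁻¹ / L) * t) =
      Real.exp (-2 * Real.log q + (2 * Real.log q / L) * t) := by
    rw [← Real.exp_log (pow_pos (inv_pos.2 hq0) 2), Real.log_pow, Real.log_inv, ← Real.exp_add]
    congr 1
    push_cast
    ring
  rw [e1, e2, Real.exp_le_exp]
  have h1 : (⌊t / L⌋₊ : ℝ) * Real.log q ≤ (t / L - 1) * Real.log q := mul_le_mul_of_nonpos_right hn hlog
  have e3 : (t / L - 1) * Real.log q * 2 = -2 * Real.log q + 2 * Real.log q / L * t := by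
    field_simp
    ring
  ring_nf at h1 e3 ⊢
  nlinarith [h1, e3]

/-- **Exponential form** (the shape of `HessChildsRowan2025_cor12`): under the hypotheses of
`ae_scalarL2Sq_le_pow` with `0 < q ≤ 1`, every weak solution from mean-zero `θ₀ ∈ L²` satisfies
`‖θ(t)‖²_{L²} ≤ q⁻² e^{-(2 log q⁻¹/L) t} ‖θ₀‖²_{L²}` for a.e. `t ∈ (0,T)` — exponential relaxation at
rate `log(q⁻¹)/L` per unit time, uniformly in the datum; with `q = C κ^γ` the rate is
`(γ log κ⁻¹ - log C)/L`. [cite: HessChildsRowan2025b, Cor. 1.2 (proof §1.3, p. 11)] -/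
theorem ae_scalarL2Sq_le_exp [Nonempty d] (hκ : 0 < κ) (ha : ∀ i, 0 < a i) (hL : 0 < L)
    (hq0 : 0 < q) (hq1 : q ≤ 1) (hper : ∀ t : ℝ, 0 ≤ t → u (t + L) = u t) (huA : ∀ t x, ‖u t x‖ ≤ A)
    (hP : ∀ φ₀ : UnitAddTorus d → ℝ, MemLp φ₀ 2 volume → ∫ x, φ₀ x = 0 →
      ∀ φ : ℝ → UnitAddTorus d → ℝ, IsWeakScalarTransportDiagOn L a κ u φ₀ φ →
        IsL2ContinuousOn (Icc 0 L) φ → Torus.scalarL2Sq (φ L) ≤ q ^ 2 * Torus.scalarL2Sq φ₀)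
    (h : IsWeakScalarTransportDiagOn T a κ u θ₀ θ) (hθ₀ : MemLp θ₀ 2 volume) (hθ₀m : ∫ x, θ₀ x = 0) :
    ∀ᵐ t ∂(volume.restrict (Ioo 0 T)),
      Torus.scalarL2Sq (θ t) ≤ q⁻¹ ^ 2 * Real.exp (-(2 * Real.log q⁻¹ / L) * t) * Torus.scalarL2Sq θ₀ := by
  filter_upwards [h.ae_scalarL2Sq_le_pow hκ ha hL hper huA hP hθ₀ hθ₀m] with t ht
  have h0 : 0 ≤ Torus.scalarL2Sq θ₀ := integral_nonneg fun x => sq_nonneg _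
  exact ht.trans (mul_le_mul_of_nonneg_right (pow_two_mul_floor_le_exp hq0 hq1 hL t) h0)

end IsWeakScalarTransportDiagOn

end Torus

end Literature.Analysis.FluidPDE

end
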